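import Summits.BirchSwinnertonDyer.BirchSwinnertonDyer.Theorems.QuadraticBranchSignedControlNoFiniteSubmoduleOfSelfDualLayers
import HarnessLib

/-!
# The Hachimori–Matsuno layer package ON THE TREE'S OWN LAYERS `Sel^{ε,str}(W/K_n)`: exhaustion of
# `Sel^{ε,str}(W/K_∞) = ⨆_n res(Sel^{ε,str}(W/K_n))` and the `Γ`-action on the layers DISCHARGED —
# what stays displayed is injectivity of the layers, the transitions, corestriction with adjointness,
# the divisible parts and the Cassels–Tate-type pairings (cell `bsd-potss`, seat `bsd-potss-k8q-c5` g3;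
# route `QuadraticBranchSignedControl`, items stmt-BirchSwinnertonDyer-19117 / 19222 / 19233)

HONEST FRAMING (cell `bsd-potss`, run/shared/lean/pub/bsd-potss/): THEOREMS ONLY, CONDITIONAL —
nothing here closes an item; BSD is not proved by any of this. Sequel of
`…NoFiniteSubmoduleOfSelfDualLayers` (signed road, p450722): there the Hachimori–Matsuno package was
displayed over ABSTRACT layers `L_n`. Here the layers ARE the tree's `strictSignedSelmerLayer W κ E ε n`
(`Sel^{ε,str}(W/K_n) ≤ H¹(K_n, W[p^∞])`, Γ_K-internal), the maps `r_n` ARE the restrictions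
`layerToInfty κ n` (as maps into `Sel^{ε,str}(W/K_∞)`, pinned by their values) and the `Γ`-action on
the layers IS `conj_γ` (pinned by its values); from the tree's DEFINITION
`strictSignedSelmerInfty = ⨆_n (strictSignedSelmerLayer n).map (layerToInfty n)` and the tree's
theorems `conjH1_mem_strictSignedSelmerLayer`, `resOfLe_comp_conjH1_holds`, `conjH1_mul_holds`,
`conjH1_one_holds` this file PROVES the package's exhaustion (given the transitions), the
compatibility `r_n ∘ conj_γ = conj_γ ∘ r_n` and the surjectivity of `conj_γ` on each layer. What stays
DISPLAYED (the genuine inputs, in print: Kobayashi Lemma 9.1; restriction `Sel^{ε,str}(K_n) →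
Sel^{ε,str}(K_{n+1})`; corestriction with res ∘ cores = norm; cofinite generation + stabilisation of
the maximal divisible subgroups from (vi); a `Γ`-invariant Cassels–Tate-type pairing with res/cores
adjoint — Flach 1990 / B. D. Kim 2007 §3–§4 read at `η`): injective `r_n`, transitions `ι_n` over
`Sel_∞`, cores + adjointness, `D_n` `p`-divisible `conj_γ`-stable with `r_{n+1}(D_{n+1}) ⊆ r_n(D_n)`
(`n ≥ m`), pairings with right kernel exactly `D_n` representing every character of `L_n/D_n`,
`conj_γ`-invariant. No label / mark / count moves.

References: [HachimoriMatsuno2000] Theorem (p. 2540); [Kobayashi2003] Def. 2.1 (p. 5), Lemma 9.1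
(p. 25); [KitajimaOtsuki2018] Lemma 4.2, Thm. 4.5 (arXiv:1607.03612 p. 18); [GreenbergLNM1716] §1;
Serre, Galois Cohomology I §2.5 (conjugation and restriction).
-/

set_option autoImplicit false
-- `Summit.BirchSwinnertonDyer.BirchSwinnertonDyer.…` is the lane's mandated namespace (sub = summit).
set_option linter.dupNamespace false

noncomputable section

open scoped Classical

universe u

open WeierstrassCurve Field Literature.NumberTheory.EllipticCurves
  Literature.NumberTheory.GaloisRepresentations ZpExtension
  Summit.BirchSwinnertonDyer.Rank1Residual Summit.BirchSwinnertonDyer.Rank1Residual.Additive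

namespace Summit.BirchSwinnertonDyer.BirchSwinnertonDyer.Theorems

open Summit.BirchSwinnertonDyer.BirchSwinnertonDyer.Theses.QuadraticBranchSignedControl

section StrictLayers

variable {K : Type u} [Field K] [NumberField K] {W : WeierstrassCurve K} {p : ℕ} [Fact p.Prime]
  {κ : ZpExtension K p} {E : Type u} [Field E] [Algebra K E] {γ : Field.absoluteGaloisGroup K} {ε : ℤˣ}

/-- **Restriction commutes with conjugation, on the strict signed layers**: for `r_n` the restriction
`Sel^{ε,str}(W/K_n) → Sel^{ε,str}(W/K_∞)` (pinned by `layerToInfty`) and `γL_n` the conjugation on the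
layer (pinned by `conj_γ`), `r_n ∘ γL_n = conj_γ ∘ r_n` (`resOfLe_comp_conjH1_holds`).
[cite: GreenbergLNM1716, §1 (the Λ-action via conjugation)] -/
theorem strictLayer_r_conj
    (r : ∀ n, strictSignedSelmerLayer W κ E ε n →+ strictSignedSelmerInfty W κ E ε)
    (hr : ∀ n (x : strictSignedSelmerLayer W κ E ε n),
      ((r n x : strictSignedSelmerInfty W κ E ε) : W.subgroupH1 p κ.kerSubgroup) =
        W.layerToInfty κ n (x : W.subgroupH1 p (κ.layerSubgroup n)))
    (γL : ∀ n, strictSignedSelmerLayer W κ E ε n →+ strictSignedSelmerLayer W κ E ε n)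
    (hγL : ∀ n (x : strictSignedSelmerLayer W κ E ε n),
      ((γL n x : strictSignedSelmerLayer W κ E ε n) : W.subgroupH1 p (κ.layerSubgroup n)) =
        W.conjH1 p (κ.layerSubgroup n) γ (x : W.subgroupH1 p (κ.layerSubgroup n)))
    (n : ℕ) (x : strictSignedSelmerLayer W κ E ε n) :
    r n (γL n x) = conjStrictSignedSelmerInfty W κ E ε γ (r n x) := by
  apply Subtype.ext
  rw [coe_conjStrictSignedSelmerInfty_apply, hr, hγL, hr]
  change ((W.resOfLe p (κ.kerSubgroup_le_layerSubgroup n)).comp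
      (W.conjH1 p (κ.layerSubgroup n) γ)) (x : W.subgroupH1 p (κ.layerSubgroup n)) = _
  rw [resOfLe_comp_conjH1_holds]
  rfl

/-- **Conjugation is onto on each strict signed layer** (`conj_γ ∘ conj_{γ⁻¹} = id`:
`conjH1_mul_holds`, `conjH1_one_holds`; `conj_{γ⁻¹}` preserves the layer,
`conjH1_mem_strictSignedSelmerLayer`). [cite: GreenbergLNM1716, §1] -/
theorem strictLayer_conj_surjective
    (γL : ∀ n, strictSignedSelmerLayer W κ E ε n →+ strictSignedSelmerLayer W κ E ε n)
    (hγL : ∀ n (x : strictSignedSelmerLayer W κ E ε n),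
      ((γL n x : strictSignedSelmerLayer W κ E ε n) : W.subgroupH1 p (κ.layerSubgroup n)) =
        W.conjH1 p (κ.layerSubgroup n) γ (x : W.subgroupH1 p (κ.layerSubgroup n)))
    (n : ℕ) : Function.Surjective (γL n) := by
  intro y
  refine ⟨⟨W.conjH1 p (κ.layerSubgroup n) γ⁻¹ (y : W.subgroupH1 p (κ.layerSubgroup n)),
    conjH1_mem_strictSignedSelmerLayer W κ E ε n γ⁻¹ y.2⟩, Subtype.ext ?_⟩
  rw [hγL]
  change ((W.conjH1 p (κ.layerSubgroup n) γ).comp (W.conjH1 p (κ.layerSubgroup n) γ⁻¹))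
      (y : W.subgroupH1 p (κ.layerSubgroup n)) = _
  rw [← W.conjH1_mul_holds p (κ.layerSubgroup n) γ γ⁻¹, mul_inv_cancel,
    W.conjH1_one_holds p (κ.layerSubgroup n), AddMonoidHom.id_apply]

/-- **Exhaustion**: `Sel^{ε,str}(W/K_∞) = ⨆_n res(Sel^{ε,str}(W/K_n))` (the tree's DEFINITION of
`strictSignedSelmerInfty`), so — given transitions `ι_n : Sel^{ε,str}(K_n) → Sel^{ε,str}(K_{n+1})` over
`Sel_∞` to collect a finite sum of layer classes in one layer — every class of `Sel^{ε,str}(W/K_∞)` is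
the restriction of a class of some layer. [cite: Kobayashi2003, Def. 2.1 (p. 5) (Sel(K_∞) = lim→ Sel(K_n))] -/
theorem strictLayer_exhaustion
    (r : ∀ n, strictSignedSelmerLayer W κ E ε n →+ strictSignedSelmerInfty W κ E ε)
    (hr : ∀ n (x : strictSignedSelmerLayer W κ E ε n),
      ((r n x : strictSignedSelmerInfty W κ E ε) : W.subgroupH1 p κ.kerSubgroup) =
        W.layerToInfty κ n (x : W.subgroupH1 p (κ.layerSubgroup n)))
    (ι : ∀ n, strictSignedSelmerLayer W κ E ε n →+ strictSignedSelmerLayer W κ E ε (n + 1))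
    (hι : ∀ n (x : strictSignedSelmerLayer W κ E ε n), r (n + 1) (ι n x) = r n x)
    (s : strictSignedSelmerInfty W κ E ε) :
    ∃ n, ∃ x : strictSignedSelmerLayer W κ E ε n, r n x = s := by
  suffices h : ∃ n, ∃ x : strictSignedSelmerLayer W κ E ε n,
      ((r n x : strictSignedSelmerInfty W κ E ε) : W.subgroupH1 p κ.kerSubgroup) = s by
    obtain ⟨n, x, hx⟩ := h
    exact ⟨n, x, Subtype.ext hx⟩
  refine AddSubgroup.iSup_induction
    (fun n => (strictSignedSelmerLayer W κ E ε n).map (W.layerToInfty κ n))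
    (C := fun a => ∃ n, ∃ x : strictSignedSelmerLayer W κ E ε n,
      ((r n x : strictSignedSelmerInfty W κ E ε) : W.subgroupH1 p κ.kerSubgroup) = a) s.2 ?_ ?_ ?_
  · rintro n a ⟨c, hc, rfl⟩
    exact ⟨n, ⟨c, hc⟩, hr n ⟨c, hc⟩⟩
  · exact ⟨0, 0, by rw [map_zero]; rfl⟩
  · rintro a b ⟨n₁, x₁, rfl⟩ ⟨n₂, x₂, rfl⟩
    obtain ⟨y₁, hy₁⟩ := Iwasawa.exists_eq_of_le_layer r ι hι ⟨x₁, rfl⟩ (Nat.le_add_right n₁ n₂)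
    obtain ⟨y₂, hy₂⟩ := Iwasawa.exists_eq_of_le_layer r ι hι ⟨x₂, rfl⟩ (Nat.le_add_left n₂ n₁)
    exact ⟨n₁ + n₂, y₁ + y₂, by rw [map_add, AddSubgroup.coe_add, hy₁, hy₂]⟩

/-- **`X^{ε,str}(W/K_∞)` has no non-zero finite `Λ`-submodule, given the Hachimori–Matsuno package ON
THE TREE'S LAYERS** `Sel^{ε,str}(W/K_n)` — for ANY number field, `ℤ_p`-extension, model, sign, `γ`,
datum `D`. The maps `r_n` and the layer action `γL_n` are pinned to `layerToInfty` and `conj_γ` by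
their values (their existence as such maps is bookkeeping: `map_layerToInfty_strictSignedSelmerLayer_le`,
`conjH1_mem_strictSignedSelmerLayer`); exhaustion, `Γ`-compatibility and `Γ`-surjectivity are PROVED
(`strictLayer_exhaustion`, `strictLayer_r_conj`, `strictLayer_conj_surjective`); DISPLAYED remain:
injective `r_n` (Kobayashi Lemma 9.1), transitions `ι_n` over `Sel_∞`, corestrictions realising
`Σ_{i<p} conj_γ^{pⁿ i}` adjoint to `ι_n`, `p`-divisible `conj_γ`-stable `D_n` with
`r_{n+1}(D_{n+1}) ⊆ r_n(D_n)` (`n ≥ m`), `conj_γ`-invariant pairings with right kernel exactly `D_n`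
representing every character of `Sel^{ε,str}(K_n)/D_n` (the generalised Cassels–Tate pairing).
CONDITIONAL; nothing about these inputs is asserted.
[cite: HachimoriMatsuno2000, Theorem and Corollary (i) (p. 2540)]
[cite: Kobayashi2003, Def. 2.1 (p. 5), Lemma 9.1 (p. 25)]
[cite: KitajimaOtsuki2018, Lemma 4.2, Prop. 4.1, Thm. 4.5 (arXiv:1607.03612 p. 18)] -/
theorem StrictSignedSelmerDualData.forall_finite_eq_bot_of_strictLayerPackage
    (D : StrictSignedSelmerDualData W κ E γ ε)
    (hpack : ∃ (r : ∀ n, strictSignedSelmerLayer W κ E ε n →+ strictSignedSelmerInfty W κ E ε)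
        (γL : ∀ n, strictSignedSelmerLayer W κ E ε n →+ strictSignedSelmerLayer W κ E ε n)
        (ι : ∀ n, strictSignedSelmerLayer W κ E ε n →+ strictSignedSelmerLayer W κ E ε (n + 1))
        (Dn : ∀ n, AddSubgroup (strictSignedSelmerLayer W κ E ε n))
        (pair : ∀ n, strictSignedSelmerLayer W κ E ε n →+ strictSignedSelmerLayer W κ E ε n →+
          AddCircle (1 : ℚ)) (m : ℕ),
      (∀ n (x : strictSignedSelmerLayer W κ E ε n),
        ((r n x : strictSignedSelmerInfty W κ E ε) : W.subgroupH1 p κ.kerSubgroup) =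
          W.layerToInfty κ n (x : W.subgroupH1 p (κ.layerSubgroup n))) ∧
      (∀ n (x : strictSignedSelmerLayer W κ E ε n),
        ((γL n x : strictSignedSelmerLayer W κ E ε n) : W.subgroupH1 p (κ.layerSubgroup n)) =
          W.conjH1 p (κ.layerSubgroup n) γ (x : W.subgroupH1 p (κ.layerSubgroup n))) ∧
      (∀ n, Function.Injective (r n)) ∧
      (∀ n (x : strictSignedSelmerLayer W κ E ε n), r (n + 1) (ι n x) = r n x) ∧
      (∀ n (t : strictSignedSelmerLayer W κ E ε (n + 1)), ∃ t' : strictSignedSelmerLayer W κ E ε n,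
        r n t' = ∑ i ∈ Finset.range p,
          ((conjStrictSignedSelmerInfty W κ E ε γ) ^ (p ^ n * i)) (r (n + 1) t) ∧
        ∀ y : strictSignedSelmerLayer W κ E ε n, pair n y t' = pair (n + 1) (ι n y) t) ∧
      (∀ n, ∀ d ∈ Dn n, ∃ d' ∈ Dn n, p • d' = d) ∧
      (∀ n, ∀ d ∈ Dn n, γL n d ∈ Dn n) ∧
      (∀ n, m ≤ n → (Dn (n + 1)).map (r (n + 1)) ≤ (Dn n).map (r n)) ∧
      (∀ n (t : strictSignedSelmerLayer W κ E ε n),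
        (∀ y : strictSignedSelmerLayer W κ E ε n, pair n y t = 0) → t ∈ Dn n) ∧
      (∀ n, ∀ t ∈ Dn n, ∀ y : strictSignedSelmerLayer W κ E ε n, pair n y t = 0) ∧
      (∀ n (g : strictSignedSelmerLayer W κ E ε n →+ AddCircle (1 : ℚ)), (∀ d ∈ Dn n, g d = 0) →
        ∃ c : strictSignedSelmerLayer W κ E ε n, ∀ y : strictSignedSelmerLayer W κ E ε n,
          g y = pair n y c) ∧
      (∀ n (y t : strictSignedSelmerLayer W κ E ε n), pair n (γL n y) (γL n t) = pair n y t)) :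
    ∀ M : Submodule (IwasawaAlgebra p) D.X, Finite M → M = ⊥ := by
  obtain ⟨r, γL, ι, Dn, pair, m, hr, hγL, hinj, hι, hcores, hDdiv, hDγ, hDst, hker, hD0, hsurj, hinv⟩ :=
    hpack
  exact StrictSignedSelmerDualData.forall_finite_eq_bot_of_layerPackage D
    ⟨fun n ↦ ↥(strictSignedSelmerLayer W κ E ε n), inferInstance, r, ι, γL, Dn, pair, m, hinj, hι,
      strictLayer_exhaustion r hr ι hι, strictLayer_r_conj r hr γL hγL,
      strictLayer_conj_surjective γL hγL, hcores, hDdiv, hDγ, hDst, hker, hD0, hsurj, hinv⟩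

end StrictLayers

/-! ## The K8 nodes from the packages on the tree's layers `Sel^{±,str}(W/ℚ_n)` -/

/-- **(R2⁺) `NoFiniteSubmodulePlus` (item stmt-BirchSwinnertonDyer-19222) from the Hachimori–Matsuno
package on the tree's layers `Sel^{+,str}(W/ℚ_n)`** (exhaustion and `Γ`-action discharged; displayed:
injective restrictions, transitions, corestriction + adjointness, divisible parts, Cassels–Tate-type
pairings). CONDITIONAL; closes nothing by itself.
[cite: HachimoriMatsuno2000, Theorem and Corollary (i) (p. 2540)]
[cite: Kobayashi2003, Def. 2.1, Thm. 2.2 (p. 5), Lemma 9.1 (p. 25)] -/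
theorem noFiniteSubmodulePlus_of_strictLayerPackage
    (h : ∀ (W : WeierstrassCurve ℚ) [W.IsElliptic] [W.IsGloballyMinimal] (p : ℕ) [Fact p.Prime]
        (V : WeierstrassCurve ℚ) [V.IsElliptic] [V.IsGloballyMinimal] (C : VariableChange ℚ),
      5 ≤ p → C • W.quadraticTwist ((-1) ^ (p / 2) * p) = V →
      V.HasGoodReductionAtPrime p → V.frobeniusTrace p = 0 →
      ∀ (κ : ZpExtension ℚ p) (γ : Field.absoluteGaloisGroup ℚ),
        κ.IsCyclotomic → κ.IsTopGenerator γ →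
      ∀ (D : StrictSignedSelmerDualData W κ ℚ_[p] γ 1),
        Module.Finite (IwasawaAlgebra p) D.X → Module.IsTorsion (IwasawaAlgebra p) D.X →
      ∃ (r : ∀ n, strictSignedSelmerLayer W κ ℚ_[p] 1 n →+ strictSignedSelmerInfty W κ ℚ_[p] 1)
        (γL : ∀ n, strictSignedSelmerLayer W κ ℚ_[p] 1 n →+ strictSignedSelmerLayer W κ ℚ_[p] 1 n)
        (ι : ∀ n, strictSignedSelmerLayer W κ ℚ_[p] 1 n →+ strictSignedSelmerLayer W κ ℚ_[p] 1 (n + 1))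
        (Dn : ∀ n, AddSubgroup (strictSignedSelmerLayer W κ ℚ_[p] 1 n))
        (pair : ∀ n, strictSignedSelmerLayer W κ ℚ_[p] 1 n →+ strictSignedSelmerLayer W κ ℚ_[p] 1 n →+ AddCircle (1 : ℚ)) (m : ℕ),
      (∀ n (x : strictSignedSelmerLayer W κ ℚ_[p] 1 n),
        ((r n x : strictSignedSelmerInfty W κ ℚ_[p] 1) : W.subgroupH1 p κ.kerSubgroup) =
          W.layerToInfty κ n (x : W.subgroupH1 p (κ.layerSubgroup n))) ∧
      (∀ n (x : strictSignedSelmerLayer W κ ℚ_[p] 1 n),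
        ((γL n x : strictSignedSelmerLayer W κ ℚ_[p] 1 n) : W.subgroupH1 p (κ.layerSubgroup n)) =
          W.conjH1 p (κ.layerSubgroup n) γ (x : W.subgroupH1 p (κ.layerSubgroup n))) ∧
      (∀ n, Function.Injective (r n)) ∧
      (∀ n (x : strictSignedSelmerLayer W κ ℚ_[p] 1 n), r (n + 1) (ι n x) = r n x) ∧
      (∀ n (t : strictSignedSelmerLayer W κ ℚ_[p] 1 (n + 1)), ∃ t' : strictSignedSelmerLayer W κ ℚ_[p] 1 n,
        r n t' = ∑ i ∈ Finset.range p,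
          ((conjStrictSignedSelmerInfty W κ ℚ_[p] 1 γ) ^ (p ^ n * i)) (r (n + 1) t) ∧
        ∀ y : strictSignedSelmerLayer W κ ℚ_[p] 1 n, pair n y t' = pair (n + 1) (ι n y) t) ∧
      (∀ n, ∀ d ∈ Dn n, ∃ d' ∈ Dn n, p • d' = d) ∧
      (∀ n, ∀ d ∈ Dn n, γL n d ∈ Dn n) ∧
      (∀ n, m ≤ n → (Dn (n + 1)).map (r (n + 1)) ≤ (Dn n).map (r n)) ∧
      (∀ n (t : strictSignedSelmerLayer W κ ℚ_[p] 1 n),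
        (∀ y : strictSignedSelmerLayer W κ ℚ_[p] 1 n, pair n y t = 0) → t ∈ Dn n) ∧
      (∀ n, ∀ t ∈ Dn n, ∀ y : strictSignedSelmerLayer W κ ℚ_[p] 1 n, pair n y t = 0) ∧
      (∀ n (g : strictSignedSelmerLayer W κ ℚ_[p] 1 n →+ AddCircle (1 : ℚ)), (∀ d ∈ Dn n, g d = 0) →
        ∃ c : strictSignedSelmerLayer W κ ℚ_[p] 1 n, ∀ y : strictSignedSelmerLayer W κ ℚ_[p] 1 n, g y = pair n y c) ∧
      (∀ n (y t : strictSignedSelmerLayer W κ ℚ_[p] 1 n), pair n (γL n y) (γL n t) = pair n y t)) :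
    NoFiniteSubmodulePlus := by
  intro W _ _ p _ hp5 V _ _ C _ hC hgood hap κ γ hκ hγ D hfin htor M hM
  exact StrictSignedSelmerDualData.forall_finite_eq_bot_of_strictLayerPackage D
    (h W p V C hp5 hC hgood hap κ γ hκ hγ D hfin htor) M hM

/-- **(R2⁻) `NoFiniteSubmoduleMinus` (item stmt-BirchSwinnertonDyer-19233) from the Hachimori–Matsuno
package on the tree's layers `Sel^{−,str}(W/ℚ_n)`** (the `m = −1` clause). CONDITIONAL; closes
nothing by itself. [cite: HachimoriMatsuno2000, Theorem and Corollary (i) (p. 2540)]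
[cite: Kobayashi2003, Def. 2.1, §2 p. 4 (m = −1), Thm. 2.2 (p. 5), Lemma 9.1 (p. 25)] -/
theorem noFiniteSubmoduleMinus_of_strictLayerPackage
    (h : ∀ (W : WeierstrassCurve ℚ) [W.IsElliptic] [W.IsGloballyMinimal] (p : ℕ) [Fact p.Prime]
        (V : WeierstrassCurve ℚ) [V.IsElliptic] [V.IsGloballyMinimal] (C : VariableChange ℚ),
      5 ≤ p → C • W.quadraticTwist ((-1) ^ (p / 2) * p) = V →
      V.HasGoodReductionAtPrime p → V.frobeniusTrace p = 0 →
      ∀ (κ : ZpExtension ℚ p) (γ : Field.absoluteGaloisGroup ℚ),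
        κ.IsCyclotomic → κ.IsTopGenerator γ →
      ∀ (D : StrictSignedSelmerDualData W κ ℚ_[p] γ (-1)),
        Module.Finite (IwasawaAlgebra p) D.X → Module.IsTorsion (IwasawaAlgebra p) D.X →
      ∃ (r : ∀ n, strictSignedSelmerLayer W κ ℚ_[p] (-1) n →+ strictSignedSelmerInfty W κ ℚ_[p] (-1))
        (γL : ∀ n, strictSignedSelmerLayer W κ ℚ_[p] (-1) n →+ strictSignedSelmerLayer W κ ℚ_[p] (-1) n)
        (ι : ∀ n, strictSignedSelmerLayer W κ ℚ_[p] (-1) n →+ strictSignedSelmerLayer W κ ℚ_[p] (-1) (n + 1))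
        (Dn : ∀ n, AddSubgroup (strictSignedSelmerLayer W κ ℚ_[p] (-1) n))
        (pair : ∀ n, strictSignedSelmerLayer W κ ℚ_[p] (-1) n →+ strictSignedSelmerLayer W κ ℚ_[p] (-1) n →+ AddCircle (1 : ℚ)) (m : ℕ),
      (∀ n (x : strictSignedSelmerLayer W κ ℚ_[p] (-1) n),
        ((r n x : strictSignedSelmerInfty W κ ℚ_[p] (-1)) : W.subgroupH1 p κ.kerSubgroup) =
          W.layerToInfty κ n (x : W.subgroupH1 p (κ.layerSubgroup n))) ∧
      (∀ n (x : strictSignedSelmerLayer W κ ℚ_[p] (-1) n),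
        ((γL n x : strictSignedSelmerLayer W κ ℚ_[p] (-1) n) : W.subgroupH1 p (κ.layerSubgroup n)) =
          W.conjH1 p (κ.layerSubgroup n) γ (x : W.subgroupH1 p (κ.layerSubgroup n))) ∧
      (∀ n, Function.Injective (r n)) ∧
      (∀ n (x : strictSignedSelmerLayer W κ ℚ_[p] (-1) n), r (n + 1) (ι n x) = r n x) ∧
      (∀ n (t : strictSignedSelmerLayer W κ ℚ_[p] (-1) (n + 1)), ∃ t' : strictSignedSelmerLayer W κ ℚ_[p] (-1) n,
        r n t' = ∑ i ∈ Finset.range p,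
          ((conjStrictSignedSelmerInfty W κ ℚ_[p] (-1) γ) ^ (p ^ n * i)) (r (n + 1) t) ∧
        ∀ y : strictSignedSelmerLayer W κ ℚ_[p] (-1) n, pair n y t' = pair (n + 1) (ι n y) t) ∧
      (∀ n, ∀ d ∈ Dn n, ∃ d' ∈ Dn n, p • d' = d) ∧
      (∀ n, ∀ d ∈ Dn n, γL n d ∈ Dn n) ∧
      (∀ n, m ≤ n → (Dn (n + 1)).map (r (n + 1)) ≤ (Dn n).map (r n)) ∧
      (∀ n (t : strictSignedSelmerLayer W κ ℚ_[p] (-1) n),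
        (∀ y : strictSignedSelmerLayer W κ ℚ_[p] (-1) n, pair n y t = 0) → t ∈ Dn n) ∧
      (∀ n, ∀ t ∈ Dn n, ∀ y : strictSignedSelmerLayer W κ ℚ_[p] (-1) n, pair n y t = 0) ∧
      (∀ n (g : strictSignedSelmerLayer W κ ℚ_[p] (-1) n →+ AddCircle (1 : ℚ)), (∀ d ∈ Dn n, g d = 0) →
        ∃ c : strictSignedSelmerLayer W κ ℚ_[p] (-1) n, ∀ y : strictSignedSelmerLayer W κ ℚ_[p] (-1) n, g y = pair n y c) ∧
      (∀ n (y t : strictSignedSelmerLayer W κ ℚ_[p] (-1) n), pair n (γL n y) (γL n t) = pair n y t)) :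
    NoFiniteSubmoduleMinus := by
  intro W _ _ p _ hp5 V _ _ C _ hC hgood hap κ γ hκ hγ D hfin htor M hM
  exact StrictSignedSelmerDualData.forall_finite_eq_bot_of_strictLayerPackage D
    (h W p V C hp5 hC hgood hap κ γ hκ hγ D hfin htor) M hM

/-- **(R2±) the K8 node `NoFiniteSubmoduleSigned` (item stmt-BirchSwinnertonDyer-19117) from both
packages on the tree's layers** (via the sign items and `noFiniteSubmoduleSigned_of_signs`).
CONDITIONAL; closes nothing by itself. [cite: HachimoriMatsuno2000, Theorem and Corollary (i) (p. 2540)]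
[cite: KitajimaOtsuki2018, Main Thm. 1.3, Prop. 4.1, Thm. 4.5 (arXiv:1607.03612 pp. 3, 18)] -/
theorem noFiniteSubmoduleSigned_of_strictLayerPackages
    (hplus : ∀ (W : WeierstrassCurve ℚ) [W.IsElliptic] [W.IsGloballyMinimal] (p : ℕ) [Fact p.Prime]
        (V : WeierstrassCurve ℚ) [V.IsElliptic] [V.IsGloballyMinimal] (C : VariableChange ℚ),
      5 ≤ p → C • W.quadraticTwist ((-1) ^ (p / 2) * p) = V →
      V.HasGoodReductionAtPrime p → V.frobeniusTrace p = 0 →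
      ∀ (κ : ZpExtension ℚ p) (γ : Field.absoluteGaloisGroup ℚ),
        κ.IsCyclotomic → κ.IsTopGenerator γ →
      ∀ (D : StrictSignedSelmerDualData W κ ℚ_[p] γ 1),
        Module.Finite (IwasawaAlgebra p) D.X → Module.IsTorsion (IwasawaAlgebra p) D.X →
      ∃ (r : ∀ n, strictSignedSelmerLayer W κ ℚ_[p] 1 n →+ strictSignedSelmerInfty W κ ℚ_[p] 1)
        (γL : ∀ n, strictSignedSelmerLayer W κ ℚ_[p] 1 n →+ strictSignedSelmerLayer W κ ℚ_[p] 1 n)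
        (ι : ∀ n, strictSignedSelmerLayer W κ ℚ_[p] 1 n →+ strictSignedSelmerLayer W κ ℚ_[p] 1 (n + 1))
        (Dn : ∀ n, AddSubgroup (strictSignedSelmerLayer W κ ℚ_[p] 1 n))
        (pair : ∀ n, strictSignedSelmerLayer W κ ℚ_[p] 1 n →+ strictSignedSelmerLayer W κ ℚ_[p] 1 n →+ AddCircle (1 : ℚ)) (m : ℕ),
      (∀ n (x : strictSignedSelmerLayer W κ ℚ_[p] 1 n),
        ((r n x : strictSignedSelmerInfty W κ ℚ_[p] 1) : W.subgroupH1 p κ.kerSubgroup) =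
          W.layerToInfty κ n (x : W.subgroupH1 p (κ.layerSubgroup n))) ∧
      (∀ n (x : strictSignedSelmerLayer W κ ℚ_[p] 1 n),
        ((γL n x : strictSignedSelmerLayer W κ ℚ_[p] 1 n) : W.subgroupH1 p (κ.layerSubgroup n)) =
          W.conjH1 p (κ.layerSubgroup n) γ (x : W.subgroupH1 p (κ.layerSubgroup n))) ∧
      (∀ n, Function.Injective (r n)) ∧
      (∀ n (x : strictSignedSelmerLayer W κ ℚ_[p] 1 n), r (n + 1) (ι n x) = r n x) ∧
      (∀ n (t : strictSignedSelmerLayer W κ ℚ_[p] 1 (n + 1)), ∃ t' : strictSignedSelmerLayer W κ ℚ_[p] 1 n,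
        r n t' = ∑ i ∈ Finset.range p,
          ((conjStrictSignedSelmerInfty W κ ℚ_[p] 1 γ) ^ (p ^ n * i)) (r (n + 1) t) ∧
        ∀ y : strictSignedSelmerLayer W κ ℚ_[p] 1 n, pair n y t' = pair (n + 1) (ι n y) t) ∧
      (∀ n, ∀ d ∈ Dn n, ∃ d' ∈ Dn n, p • d' = d) ∧
      (∀ n, ∀ d ∈ Dn n, γL n d ∈ Dn n) ∧
      (∀ n, m ≤ n → (Dn (n + 1)).map (r (n + 1)) ≤ (Dn n).map (r n)) ∧
      (∀ n (t : strictSignedSelmerLayer W κ ℚ_[p] 1 n),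
        (∀ y : strictSignedSelmerLayer W κ ℚ_[p] 1 n, pair n y t = 0) → t ∈ Dn n) ∧
      (∀ n, ∀ t ∈ Dn n, ∀ y : strictSignedSelmerLayer W κ ℚ_[p] 1 n, pair n y t = 0) ∧
      (∀ n (g : strictSignedSelmerLayer W κ ℚ_[p] 1 n →+ AddCircle (1 : ℚ)), (∀ d ∈ Dn n, g d = 0) →
        ∃ c : strictSignedSelmerLayer W κ ℚ_[p] 1 n, ∀ y : strictSignedSelmerLayer W κ ℚ_[p] 1 n, g y = pair n y c) ∧
      (∀ n (y t : strictSignedSelmerLayer W κ ℚ_[p] 1 n), pair n (γL n y) (γL n t) = pair n y t))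
    (hminus : ∀ (W : WeierstrassCurve ℚ) [W.IsElliptic] [W.IsGloballyMinimal] (p : ℕ) [Fact p.Prime]
        (V : WeierstrassCurve ℚ) [V.IsElliptic] [V.IsGloballyMinimal] (C : VariableChange ℚ),
      5 ≤ p → C • W.quadraticTwist ((-1) ^ (p / 2) * p) = V →
      V.HasGoodReductionAtPrime p → V.frobeniusTrace p = 0 →
      ∀ (κ : ZpExtension ℚ p) (γ : Field.absoluteGaloisGroup ℚ),
        κ.IsCyclotomic → κ.IsTopGenerator γ →
      ∀ (D : StrictSignedSelmerDualData W κ ℚ_[p] γ (-1)),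
        Module.Finite (IwasawaAlgebra p) D.X → Module.IsTorsion (IwasawaAlgebra p) D.X →
      ∃ (r : ∀ n, strictSignedSelmerLayer W κ ℚ_[p] (-1) n →+ strictSignedSelmerInfty W κ ℚ_[p] (-1))
        (γL : ∀ n, strictSignedSelmerLayer W κ ℚ_[p] (-1) n →+ strictSignedSelmerLayer W κ ℚ_[p] (-1) n)
        (ι : ∀ n, strictSignedSelmerLayer W κ ℚ_[p] (-1) n →+ strictSignedSelmerLayer W κ ℚ_[p] (-1) (n + 1))
        (Dn : ∀ n, AddSubgroup (strictSignedSelmerLayer W κ ℚ_[p] (-1) n))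
        (pair : ∀ n, strictSignedSelmerLayer W κ ℚ_[p] (-1) n →+ strictSignedSelmerLayer W κ ℚ_[p] (-1) n →+ AddCircle (1 : ℚ)) (m : ℕ),
      (∀ n (x : strictSignedSelmerLayer W κ ℚ_[p] (-1) n),
        ((r n x : strictSignedSelmerInfty W κ ℚ_[p] (-1)) : W.subgroupH1 p κ.kerSubgroup) =
          W.layerToInfty κ n (x : W.subgroupH1 p (κ.layerSubgroup n))) ∧
      (∀ n (x : strictSignedSelmerLayer W κ ℚ_[p] (-1) n),
        ((γL n x : strictSignedSelmerLayer W κ ℚ_[p] (-1) n) : W.subgroupH1 p (κ.layerSubgroup n)) =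
          W.conjH1 p (κ.layerSubgroup n) γ (x : W.subgroupH1 p (κ.layerSubgroup n))) ∧
      (∀ n, Function.Injective (r n)) ∧
      (∀ n (x : strictSignedSelmerLayer W κ ℚ_[p] (-1) n), r (n + 1) (ι n x) = r n x) ∧
      (∀ n (t : strictSignedSelmerLayer W κ ℚ_[p] (-1) (n + 1)), ∃ t' : strictSignedSelmerLayer W κ ℚ_[p] (-1) n,
        r n t' = ∑ i ∈ Finset.range p,
          ((conjStrictSignedSelmerInfty W κ ℚ_[p] (-1) γ) ^ (p ^ n * i)) (r (n + 1) t) ∧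
        ∀ y : strictSignedSelmerLayer W κ ℚ_[p] (-1) n, pair n y t' = pair (n + 1) (ι n y) t) ∧
      (∀ n, ∀ d ∈ Dn n, ∃ d' ∈ Dn n, p • d' = d) ∧
      (∀ n, ∀ d ∈ Dn n, γL n d ∈ Dn n) ∧
      (∀ n, m ≤ n → (Dn (n + 1)).map (r (n + 1)) ≤ (Dn n).map (r n)) ∧
      (∀ n (t : strictSignedSelmerLayer W κ ℚ_[p] (-1) n),
        (∀ y : strictSignedSelmerLayer W κ ℚ_[p] (-1) n, pair n y t = 0) → t ∈ Dn n) ∧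
      (∀ n, ∀ t ∈ Dn n, ∀ y : strictSignedSelmerLayer W κ ℚ_[p] (-1) n, pair n y t = 0) ∧
      (∀ n (g : strictSignedSelmerLayer W κ ℚ_[p] (-1) n →+ AddCircle (1 : ℚ)), (∀ d ∈ Dn n, g d = 0) →
        ∃ c : strictSignedSelmerLayer W κ ℚ_[p] (-1) n, ∀ y : strictSignedSelmerLayer W κ ℚ_[p] (-1) n, g y = pair n y c) ∧
      (∀ n (y t : strictSignedSelmerLayer W κ ℚ_[p] (-1) n), pair n (γL n y) (γL n t) = pair n y t)) :
    NoFiniteSubmoduleSigned :=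
  noFiniteSubmoduleSigned_of_signs (noFiniteSubmodulePlus_of_strictLayerPackage hplus)
    (noFiniteSubmoduleMinus_of_strictLayerPackage hminus)

end Summit.BirchSwinnertonDyer.BirchSwinnertonDyer.Theorems

end
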